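import Summits.FinalStateConjecture.FinalStateConjecture.Theorems.ClusterCompletenessOmegaLimitMultiKerrSketchInnerHorizonMasqueradeHorizon
import HarnessLib

/-!
# Crux `ClusterCompleteness.OmegaLimitMultiKerr` (stmt-FinalStateConjecture-17639), line `Sketch` v8 —
# the INNER-HORIZON MASQUERADE, part 3: the `C⁰` anchor `‖G − g_{(1+ν²)/2, ν}‖ ≤ 1/32` on `{r_ν > 1}`

Part 3 of the wave-4 audit witness (parts 1–2: `…SketchInnerHorizonMasquerade`, `…MasqueradeHorizon`, the latter
with the zeroth-order size `‖g_{1,a} − η‖ ≤ 8/r_a`). With `k = g_{1,1} − η` (a FIXED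
smooth field), homogeneity and linearity in the mass give
`g_{M₁,1}(y) = η + M₁ k(y)` and `g_{M,ν}(x) = η + M₁ k(x/ν)` (`M = (1+ν²)/2 = ν M₁`), so that

  `G(x)(v,w) − g_{M,ν}(x)(v,w) = [η(Bv,Bw) − η(v,w)] + M₁ [k(Bx)(Bv,Bw) − k(x/ν)(v,w)]`.

The first bracket is `(ν² − 1) v³w³`; in the second, `‖k(y)‖ ≤ 8/r_1(y)` (`norm_ksPert_one_le`), `‖Bv − v‖ ≤
(1 − ν)‖v‖`, and `‖k(Bx) − k(x/ν)‖` is `≤ 40/R` far out (`r_ν ≥ R ≥ 4`, both terms decay) and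
`≤ C₁ (ν⁻¹ − ν)(r_ν + 1)` in the near zone by the mean value inequality along the segment from the
time-adjusted `x/ν` to `Bx`, which stays in `{r_1 > 1/4}` where `‖Dk‖ ≤ C₁`
(`exists_bound_iteratedFDeriv_ksPert`). Choosing `1 − ν = 2⁻²³/(|C₁| + 1)` makes the total `≤ 1/32`
(`squeezed_anchor`).
-/

set_option linter.dupNamespace false
set_option maxSynthPendingDepth 3

noncomputable section

open scoped Topology Manifold ContDiff
open Filter Set Function TopologicalSpace Literature.Geometry.Lorentzian
open Summit.FinalStateConjecture.FinalStateConjecture.Theorems.SublinearIsFree.Rechart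
  (exists_bound_iteratedFDeriv_ksPert)

namespace Summit.FinalStateConjecture.FinalStateConjecture.Theorems.ClusterCompleteness

/-! ### The pointwise decomposition of `G − g_{M,ν}` -/

section Anchor

variable {ν : ℝ} {B : E4 →L[ℝ] E4}
  (hB : ∀ w : E4, B w = w + ((ν - 1) * w 3) • E4.basisVector 3)
  {G : E4 → E4 →L[ℝ] E4 →L[ℝ] ℝ}
  (hG : ∀ y v w, G y v w = Kerr.bilin ((1 + ν ^ 2) / (2 * ν)) 1 (B y) (B v) (B w))

include hB in
/-- `η(Bv, Bw) − η(v, w) = (ν² − 1) v³ w³`. [folklore] -/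
theorem minkowski_squeeze_sub (v w : E4) :
    Minkowski.bilin (B v) (B w) - Minkowski.bilin v w = (ν ^ 2 - 1) * (v 3 * w 3) := by
  simp only [Minkowski.bilin_apply, Fin.sum_univ_three]
  rw [show ((0 : Fin 3).succ : Fin 4) = 1 from rfl, show ((1 : Fin 3).succ : Fin 4) = 2 from rfl,
    show ((2 : Fin 3).succ : Fin 4) = 3 from rfl]
  rw [squeeze_apply_three hB, squeeze_apply_three hB, squeeze_apply_of_ne_three hB v (by decide),
    squeeze_apply_of_ne_three hB v (by decide), squeeze_apply_of_ne_three hB v (by decide),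
    squeeze_apply_of_ne_three hB w (by decide), squeeze_apply_of_ne_three hB w (by decide),
    squeeze_apply_of_ne_three hB w (by decide)]
  ring

include hG in
/-- **The decomposition** `G(x)(v,w) − g_{M,ν}(x)(v,w) = [η(Bv,Bw) − η(v,w)] + M₁[k(Bx)(Bv,Bw) − k(x/ν)(v,w)]`,
`k = g_{1,1} − η`, `M = (1+ν²)/2 = ν M₁` (homogeneity `g_{M,ν}(x) − η = M₁ k(x/ν)`,
`Kerr.ksPert_smul`). [folklore] -/
theorem squeezed_sub_apply (hν : 0 < ν) (x v w : E4) :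
    G x v w - Kerr.bilin ((1 + ν ^ 2) / 2) ν x v w =
      (Minkowski.bilin (B v) (B w) - Minkowski.bilin v w) +
        (1 + ν ^ 2) / (2 * ν) * ((Kerr.bilin 1 1 (B x) - Minkowski.bilin) (B v) (B w) -
          (Kerr.bilin 1 1 (ν⁻¹ • x) - Minkowski.bilin) v w) := by
  have h1 : Kerr.bilin ((1 + ν ^ 2) / (2 * ν)) 1 (B x) (B v) (B w) = Minkowski.bilin (B v) (B w) +
      (1 + ν ^ 2) / (2 * ν) * (Kerr.bilin 1 1 (B x) - Minkowski.bilin) (B v) (B w) := by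
    rw [kerr_bilin_eq_add_smul_ksPert ((1 + ν ^ 2) / (2 * ν)) 1 (B x)]
    rfl
  have h2 : Kerr.bilin ((1 + ν ^ 2) / 2) ν x v w = Minkowski.bilin v w +
      (1 + ν ^ 2) / (2 * ν) * (Kerr.bilin 1 1 (ν⁻¹ • x) - Minkowski.bilin) v w := by
    have h3 := Kerr.ksPert_smul (inv_pos.2 hν) ((1 + ν ^ 2) / 2) ν x
    rw [inv_mul_cancel₀ hν.ne', show ν⁻¹ * ((1 + ν ^ 2) / 2) = (1 + ν ^ 2) / (2 * ν) by
      field_simp] at h3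
    have h4 : Kerr.bilin ((1 + ν ^ 2) / 2) ν x = Minkowski.bilin +
        ((1 + ν ^ 2) / (2 * ν)) • (Kerr.bilin 1 1 (ν⁻¹ • x) - Minkowski.bilin) := by
      rw [← h3, add_sub_cancel]
    rw [h4]
    rfl
  rw [hG, h1, h2]
  ring

/-! ### The far zone: both perturbations are small -/

include hB in
/-- Far out the squeezed point is far out: `4 ≤ R ≤ r_ν(x)`, `1/2 ≤ ν ≤ 1` give `R/4 ≤ r_1(Bx)`
(`r_1(Bx)² ≥ ‖(Bx)⃗‖² − 1 ≥ ν² r_ν(x)² − 1`). [folklore] -/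
theorem div_four_le_radius_squeeze (hν : 1 / 2 ≤ ν) (hν1 : ν ≤ 1) {R : ℝ} (hR : 4 ≤ R) {x : E4}
    (hx : R ≤ Kerr.radius ν x) : R / 4 ≤ Kerr.radius 1 (B x) := by
  have h1 := Kerr.spatialNorm_sq_sub_sq_le_radius_sq 1 (B x)
  have h2 := Kerr.radius_le_spatialNorm ν x
  have h3 : E4.spatialNorm (B x) ^ 2 = x 1 ^ 2 + x 2 ^ 2 + ν ^ 2 * x 3 ^ 2 := by
    rw [E4.spatialNorm_sq, squeeze_apply_three hB, squeeze_apply_of_ne_three hB x (by decide),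
      squeeze_apply_of_ne_three hB x (by decide)]
    ring
  have h4 := E4.spatialNorm_sq x
  have hν2 : ν ^ 2 ≤ 1 := by nlinarith
  have hν3 : 1 / 4 ≤ ν ^ 2 := by nlinarith
  have h5 : ν ^ 2 * E4.spatialNorm x ^ 2 ≤ E4.spatialNorm (B x) ^ 2 := by
    rw [h3, h4]
    nlinarith [mul_nonneg (sub_nonneg.2 hν2) (add_nonneg (sq_nonneg (x 1)) (sq_nonneg (x 2)))]
  have h6 : 0 ≤ Kerr.radius ν x := Kerr.radius_nonneg ν x
  have h7 : R ^ 2 ≤ Kerr.radius ν x ^ 2 := by nlinarith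
  have h8 : Kerr.radius ν x ^ 2 ≤ E4.spatialNorm x ^ 2 := by nlinarith [E4.spatialNorm_nonneg x]
  have s1 : ν ^ 2 * R ^ 2 ≤ ν ^ 2 * E4.spatialNorm x ^ 2 := mul_le_mul_of_nonneg_left (h7.trans h8) (sq_nonneg ν)
  have s2 : 1 / 4 * R ^ 2 ≤ ν ^ 2 * R ^ 2 := mul_le_mul_of_nonneg_right hν3 (sq_nonneg R)
  have hR2 : 16 ≤ R ^ 2 := by nlinarith
  have h9 : (R / 4) ^ 2 ≤ Kerr.radius 1 (B x) ^ 2 := by nlinarith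
  exact le_of_pow_le_pow_left₀ two_ne_zero (Kerr.radius_nonneg 1 (B x)) h9

include hB in
/-- Far-zone bound: `‖k(Bx)‖ + ‖k(x/ν)‖ ≤ 40/R` for `4 ≤ R ≤ r_ν(x)`, `1/2 ≤ ν ≤ 1` (`k = g_{1,1} − η`,
`r_1(x/ν) = r_ν(x)/ν`). [folklore] -/
theorem far_ksPert_le (hν : 1 / 2 ≤ ν) (hν1 : ν ≤ 1) {R : ℝ} (hR : 4 ≤ R) {x : E4} (hx : R ≤ Kerr.radius ν x) :
    ‖Kerr.bilin 1 1 (B x) - Minkowski.bilin‖ + ‖Kerr.bilin 1 1 (ν⁻¹ • x) - Minkowski.bilin‖ ≤ 40 / R := by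
  have hν0 : 0 < ν := by linarith
  have hR0 : 0 < R := by linarith
  have h1 : R / 4 ≤ Kerr.radius 1 (B x) := div_four_le_radius_squeeze hB hν hν1 hR hx
  have h1' : 0 < Kerr.radius 1 (B x) := lt_of_lt_of_le (by positivity) h1
  have h2 : Kerr.radius 1 (ν⁻¹ • x) = ν⁻¹ * Kerr.radius ν x := by
    have := Kerr.radius_smul (inv_pos.2 hν0) ν x
    rwa [inv_mul_cancel₀ hν0.ne'] at this
  have h3 : R ≤ Kerr.radius 1 (ν⁻¹ • x) := by
    rw [h2]
    have : 1 ≤ ν⁻¹ := one_le_inv_iff₀.2 ⟨hν0, hν1⟩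
    nlinarith [Kerr.radius_nonneg ν x]
  have h3' : 0 < Kerr.radius 1 (ν⁻¹ • x) := hR0.trans_le h3
  calc ‖Kerr.bilin 1 1 (B x) - Minkowski.bilin‖ + ‖Kerr.bilin 1 1 (ν⁻¹ • x) - Minkowski.bilin‖
      ≤ 8 / Kerr.radius 1 (B x) + 8 / Kerr.radius 1 (ν⁻¹ • x) :=
        add_le_add (norm_ksPert_one_le h1') (norm_ksPert_one_le h3')
    _ ≤ 8 / (R / 4) + 8 / R := by gcongr
    _ = 40 / R := by field_simp; ring

/-! ### The near zone: the mean value inequality along the segment from `x/ν` to `Bx` -/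

/-- Along the segment from (the time-adjusted) `x/ν` to `Bx` one stays in `{r_1 > 1/4}`: a point `z` with
`z¹ = αx¹`, `z² = αx²`, `z³ = βx³`, `α ≥ 1`, `β ≥ 1/2`, has `r_1(z) > 1/4` when `r_ν(x) > 1`, `1/2 ≤ ν ≤ 1`
(spheroid test: `(x₁² + x₂²) + (1 + ν²)x₃² > 1 + ν² ≥ 5/4`). [folklore] -/
theorem quarter_lt_radius_of_scaled {ν : ℝ} (hν : 1 / 2 ≤ ν) (hν1 : ν ≤ 1) {x z : E4}
    (hx : 1 < Kerr.radius ν x) {α β : ℝ} (hα : 1 ≤ α) (hβ : 1 / 2 ≤ β) (hz1 : z 1 = α * x 1)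
    (hz2 : z 2 = α * x 2) (hz3 : z 3 = β * x 3) : 1 / 4 < Kerr.radius 1 z := by
  rw [lt_radius_iff_spheroid ν one_pos] at hx
  rw [lt_radius_iff_spheroid 1 (by norm_num : (0 : ℝ) < 1 / 4), hz1, hz2, hz3]
  have hα2 : 1 ≤ α ^ 2 := by nlinarith
  have hβ2 : 1 / 4 ≤ β ^ 2 := by nlinarith
  have hν2 : 1 / 4 ≤ ν ^ 2 := by nlinarith
  have hν3 : ν ^ 2 ≤ 1 := by nlinarith
  have hs : 0 ≤ x 1 ^ 2 + x 2 ^ 2 := by positivity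
  have h3 : 0 ≤ x 3 ^ 2 := sq_nonneg _
  nlinarith [mul_le_mul_of_nonneg_right hα2 hs, mul_le_mul_of_nonneg_right hβ2 h3,
    mul_le_mul_of_nonneg_right hν3 h3]

include hB in
/-- **Near-zone bound** by the mean value inequality: if `‖Dk‖ ≤ C₁` on `{r_1 ≥ 1/4}` then
`‖k(Bx) − k(x/ν)‖ ≤ C₁ (ν⁻¹ − ν)(r_ν(x) + 1)` for `r_ν(x) > 1`, `1/2 ≤ ν ≤ 1` (stationarity moves `x/ν`
to the time of `Bx`; the displacement is then spatial, of size `≤ (ν⁻¹ − ν)‖x⃗‖ ≤ (ν⁻¹ − ν)(r_ν + 1)`).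
[folklore] -/
theorem near_ksPert_sub_le (hν : 1 / 2 ≤ ν) (hν1 : ν ≤ 1) {C₁ : ℝ}
    (hC₁ : ∀ y : E4, 1 / 4 ≤ Kerr.radius 1 y →
      ‖fderiv ℝ (fun y ↦ Kerr.bilin 1 1 y - Minkowski.bilin) y‖ ≤ C₁)
    {x : E4} (hx : 1 < Kerr.radius ν x) :
    ‖(Kerr.bilin 1 1 (B x) - Minkowski.bilin) - (Kerr.bilin 1 1 (ν⁻¹ • x) - Minkowski.bilin)‖ ≤
      C₁ * ((ν⁻¹ - ν) * (Kerr.radius ν x + 1)) := by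
  have hν0 : 0 < ν := by linarith
  set k : E4 → E4 →L[ℝ] E4 →L[ℝ] ℝ := fun y ↦ Kerr.bilin 1 1 y - Minkowski.bilin with hk
  -- the time-adjusted point `q = x/ν + (1 − ν⁻¹) x⁰ e₀`, same spatial part as `x/ν`, same time as `Bx`
  set q : E4 := ν⁻¹ • x + ((1 - ν⁻¹) * x 0) • E4.basisVector 0 with hq
  have hkq : k (ν⁻¹ • x) = k q := by
    simp only [hk, hq, Kerr.bilin_add_smul_basisVector_zero]
  have hq0 : q 0 = x 0 := by
    rw [hq, PiLp.add_apply, PiLp.smul_apply, PiLp.smul_apply,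
      show (E4.basisVector 0 : E4) 0 = 1 by simp [E4.basisVector]]
    simp only [smul_eq_mul, mul_one]
    ring
  have hqi : ∀ i : Fin 4, i ≠ 0 → q i = ν⁻¹ * x i := fun i hi ↦ by
    rw [hq, PiLp.add_apply, PiLp.smul_apply, PiLp.smul_apply,
      show (E4.basisVector 0 : E4) i = 0 by simp [E4.basisVector, hi]]
    simp
  -- the segment and the derivative bound on it
  have hseg : ∀ z ∈ segment ℝ q (B x), 1 / 4 < Kerr.radius 1 z := by
    rintro z ⟨s, t, hs, ht, hst, rfl⟩
    refine quarter_lt_radius_of_scaled hν hν1 hx (α := s * ν⁻¹ + t) (β := s * ν⁻¹ + t * ν) ?_ ?_ ?_ ?_ ?_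
    · have : 1 ≤ ν⁻¹ := one_le_inv_iff₀.2 ⟨hν0, hν1⟩
      nlinarith
    · have : ν ≤ ν⁻¹ := hν1.trans (one_le_inv_iff₀.2 ⟨hν0, hν1⟩)
      nlinarith
    · rw [PiLp.add_apply, PiLp.smul_apply, PiLp.smul_apply, hqi 1 (by decide),
        squeeze_apply_of_ne_three hB x (by decide)]
      simp only [smul_eq_mul]
      ring
    · rw [PiLp.add_apply, PiLp.smul_apply, PiLp.smul_apply, hqi 2 (by decide),
        squeeze_apply_of_ne_three hB x (by decide)]
      simp only [smul_eq_mul]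
      ring
    · rw [PiLp.add_apply, PiLp.smul_apply, PiLp.smul_apply, hqi 3 (by decide), squeeze_apply_three hB]
      simp only [smul_eq_mul]
      ring
  have hdiff : ∀ z ∈ segment ℝ q (B x), DifferentiableAt ℝ k z := fun z hz ↦
    (Kerr.contDiffAt_ksPert (M := 1) (n := 1) (by linarith [hseg z hz])).differentiableAt one_ne_zero
  have hbd : ∀ z ∈ segment ℝ q (B x), ‖fderiv ℝ k z‖ ≤ C₁ := fun z hz ↦ hC₁ z (hseg z hz).le
  have hmvt := (convex_segment q (B x)).norm_image_sub_le_of_norm_fderiv_le hdiff hbd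
    (left_mem_segment ℝ q (B x)) (right_mem_segment ℝ q (B x))
  -- the displacement
  have hdisp : ‖B x - q‖ ≤ (ν⁻¹ - ν) * (Kerr.radius ν x + 1) := by
    have hc : 0 ≤ ν⁻¹ - ν := by
      have : ν ≤ ν⁻¹ := hν1.trans (one_le_inv_iff₀.2 ⟨hν0, hν1⟩)
      linarith
    have hn : ‖B x - q‖ ^ 2 = (B x - q) 0 ^ 2 + (B x - q) 1 ^ 2 + (B x - q) 2 ^ 2 + (B x - q) 3 ^ 2 := by
      rw [EuclideanSpace.real_norm_sq_eq, Fin.sum_univ_four]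
    simp only [PiLp.sub_apply] at hn
    rw [squeeze_apply_three hB, squeeze_apply_of_ne_three hB x (by decide),
      squeeze_apply_of_ne_three hB x (by decide), squeeze_apply_of_ne_three hB x (by decide), hq0,
      hqi 1 (by decide), hqi 2 (by decide), hqi 3 (by decide)] at hn
    -- `‖Bx − q‖² ≤ (ν⁻¹ − ν)² ‖x⃗‖²`
    have h1 : (1 - ν⁻¹) ^ 2 ≤ (ν⁻¹ - ν) ^ 2 := by
      have e1 : ν⁻¹ - ν = (1 - ν) * (1 + ν) * ν⁻¹ := by field_simp; ring
      have e2 : 1 - ν⁻¹ = -((1 - ν) * ν⁻¹) := by field_simp; ring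
      rw [e1, e2, neg_sq]
      have : ((1 - ν) * ν⁻¹) ^ 2 * 1 ≤ ((1 - ν) * ν⁻¹) ^ 2 * (1 + ν) ^ 2 :=
        mul_le_mul_of_nonneg_left (by nlinarith) (sq_nonneg _)
      nlinarith
    have hρ := E4.spatialNorm_sq x
    have h2 : ‖B x - q‖ ^ 2 ≤ ((ν⁻¹ - ν) * E4.spatialNorm x) ^ 2 := by
      rw [hn, mul_pow, hρ]
      nlinarith [mul_le_mul_of_nonneg_right h1 (sq_nonneg (x 1)), mul_le_mul_of_nonneg_right h1 (sq_nonneg (x 2)),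
        sq_nonneg (x 3), sq_nonneg (ν⁻¹ - ν)]
    have h3 : ‖B x - q‖ ≤ (ν⁻¹ - ν) * E4.spatialNorm x :=
      le_of_pow_le_pow_left₀ two_ne_zero (mul_nonneg hc (E4.spatialNorm_nonneg x)) h2
    have h4 : E4.spatialNorm x ≤ Kerr.radius ν x + 1 := by
      have h5 := Kerr.spatialNorm_sq_sub_sq_le_radius_sq ν x
      have h6 : E4.spatialNorm x ^ 2 ≤ (Kerr.radius ν x + 1) ^ 2 := by
        nlinarith [Kerr.radius_nonneg ν x]
      exact le_of_pow_le_pow_left₀ two_ne_zero (by positivity) h6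
    exact h3.trans (mul_le_mul_of_nonneg_left h4 hc)
  have hC0 : 0 ≤ C₁ := (norm_nonneg _).trans (hbd q (left_mem_segment ℝ q (B x)))
  show ‖k (B x) - k (ν⁻¹ • x)‖ ≤ _
  rw [hkq]
  exact hmvt.trans (mul_le_mul_of_nonneg_left hdisp hC0)

/-! ### The anchor -/

/-- A uniform bound `C₁ ≥ 0` of `‖D(g_{1,1} − η)‖` on `{r_1 ≥ 1/4}` (from `exists_bound_iteratedFDeriv_ksPert`
at order `1`, `‖Df‖ = ‖D¹f‖`). [folklore] -/
theorem exists_bound_fderiv_ksPert_one_one :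
    ∃ C₁ : ℝ, 0 ≤ C₁ ∧ ∀ y : E4, 1 / 4 ≤ Kerr.radius 1 y →
      ‖fderiv ℝ (fun y ↦ Kerr.bilin 1 1 y - Minkowski.bilin) y‖ ≤ C₁ := by
  obtain ⟨C, hC⟩ := exists_bound_iteratedFDeriv_ksPert 1 1 (by norm_num : (0 : ℝ) < 1 / 4) 1
  refine ⟨|C|, abs_nonneg C, fun y hy ↦ ?_⟩
  have h := hC y hy
  rw [← norm_iteratedFDeriv_fderiv, norm_iteratedFDeriv_zero] at h
  exact h.trans (le_abs_self C)

set_option maxHeartbeats 400000 in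
include hB hG in
/-- **The `C⁰` anchor of the masquerade.** If `‖D(g_{1,1} − η)‖ ≤ C₁` on `{r_1 ≥ 1/4}` and
`1 − 2⁻²³/(C₁ + 1) ≤ ν < 1`, then
`‖G(x) − g_{(1+ν²)/2, ν}(x)‖ ≤ 1/32` for every `x` with `r_ν(x) > 1`. [folklore] -/
theorem squeezed_anchor {C₁ : ℝ} (hC0 : 0 ≤ C₁)
    (hC₁ : ∀ y : E4, 1 / 4 ≤ Kerr.radius 1 y →
      ‖fderiv ℝ (fun y ↦ Kerr.bilin 1 1 y - Minkowski.bilin) y‖ ≤ C₁)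
    (hνlo : 1 - 1 / (8388608 * (C₁ + 1)) ≤ ν) (hν1 : ν < 1) {x : E4} (hx : 1 < Kerr.radius ν x) :
    ‖G x - Kerr.bilin ((1 + ν ^ 2) / 2) ν x‖ ≤ 1 / 32 := by
  -- sizes of `ε = 1 − ν ≤ 2⁻²³/(C₁ + 1)`
  set ε : ℝ := 1 / (8388608 * (C₁ + 1)) with hε
  have hε0 : 0 < ε := by positivity
  have hεle : ε ≤ 1 / 8388608 := by
    rw [hε]
    exact div_le_div_of_nonneg_left zero_le_one (by norm_num) (by nlinarith)
  have hεC : ε * C₁ ≤ 1 / 8388608 := by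
    have : ε * (C₁ + 1) = 1 / 8388608 := by
      rw [hε]
      field_simp
    nlinarith
  have h1ν : 1 - ν ≤ ε := by linarith
  have hν : 1 / 2 ≤ ν := by linarith
  have hν0 : 0 < ν := by linarith
  have hinv2 : ν⁻¹ ≤ 2 := by
    rw [inv_eq_one_div, div_le_iff₀ hν0]
    linarith
  have hνinv : ν⁻¹ - ν ≤ 4 * (1 - ν) := by
    have e1 : ν⁻¹ - ν = (1 - ν) * ((1 + ν) * ν⁻¹) := by
      field_simp
      ring
    have e2 : (1 + ν) * ν⁻¹ ≤ 4 :=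
      calc (1 + ν) * ν⁻¹ ≤ 2 * 2 := mul_le_mul (by linarith) hinv2 (inv_pos.2 hν0).le zero_le_two
        _ = 4 := by norm_num
    rw [e1]
    calc (1 - ν) * ((1 + ν) * ν⁻¹) ≤ (1 - ν) * 4 := mul_le_mul_of_nonneg_left e2 (by linarith)
      _ = 4 * (1 - ν) := by ring
  have hM₁ : (1 + ν ^ 2) / (2 * ν) ≤ 5 / 4 := by
    rw [div_le_div_iff₀ (by positivity) (by norm_num)]
    nlinarith
  have hM₁0 : 0 ≤ (1 + ν ^ 2) / (2 * ν) := by positivity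
  -- the three ingredients at the point `x`
  have hBx : ν < Kerr.radius 1 (B x) := (nu_lt_radius_squeeze_iff hB hν0 x).2 hx
  have hBx0 : 0 < Kerr.radius 1 (B x) := hν0.trans hBx
  have hk : ‖Kerr.bilin 1 1 (B x) - Minkowski.bilin‖ ≤ 16 := by
    refine (norm_ksPert_one_le hBx0).trans ?_
    rw [div_le_iff₀ hBx0]
    linarith
  have hT3 : (1 + ν ^ 2) / (2 * ν) *
      ‖(Kerr.bilin 1 1 (B x) - Minkowski.bilin) - (Kerr.bilin 1 1 (ν⁻¹ • x) - Minkowski.bilin)‖ ≤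
        1 / 128 + 1 / 128 := by
    rcases le_or_gt 8192 (Kerr.radius ν x) with hfar | hnear
    · -- far zone
      have h := far_ksPert_le hB hν hν1.le (by norm_num : (4 : ℝ) ≤ 8192) hfar
      have h' : ‖(Kerr.bilin 1 1 (B x) - Minkowski.bilin) - (Kerr.bilin 1 1 (ν⁻¹ • x) - Minkowski.bilin)‖ ≤
          40 / 8192 := (norm_sub_le _ _).trans h
      calc _ ≤ 5 / 4 * (40 / 8192) := mul_le_mul hM₁ h' (norm_nonneg _) (by norm_num)
        _ ≤ 1 / 128 + 1 / 128 := by norm_num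
    · -- near zone
      have h := near_ksPert_sub_le hB hν hν1.le hC₁ hx
      have h' : C₁ * ((ν⁻¹ - ν) * (Kerr.radius ν x + 1)) ≤ C₁ * (4 * ε * 8193) := by
        refine mul_le_mul_of_nonneg_left ?_ hC0
        have : (ν⁻¹ - ν) ≤ 4 * ε := hνinv.trans (by linarith)
        exact mul_le_mul this (by linarith) (by linarith [Kerr.radius_nonneg ν x]) (by positivity)
      calc _ ≤ 5 / 4 * (C₁ * (4 * ε * 8193)) := mul_le_mul hM₁ (h.trans h') (norm_nonneg _) (by norm_num)
        _ = 5 * 8193 * (ε * C₁) := by ring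
        _ ≤ 5 * 8193 * (1 / 8388608) := mul_le_mul_of_nonneg_left hεC (by norm_num)
        _ ≤ 1 / 128 + 1 / 128 := by norm_num
  -- assemble with `opNorm_le_bound₂`
  refine ContinuousLinearMap.opNorm_le_bound₂ _ (by norm_num) fun v w ↦ ?_
  rw [sub_apply, sub_apply, squeezed_sub_apply hG hν0,
    Real.norm_eq_abs]
  set kB := Kerr.bilin 1 1 (B x) - Minkowski.bilin with hkB
  set kq := Kerr.bilin 1 1 (ν⁻¹ • x) - Minkowski.bilin with hkq
  have e0 : kB (B v) (B w) - kq v w = (kB (B v - v) (B w) + kB v (B w - w)) + (kB - kq) v w := by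
    simp only [map_sub, sub_apply]
    ring
  have hT1 : |Minkowski.bilin (B v) (B w) - Minkowski.bilin v w| ≤ (1 - ν ^ 2) * (‖v‖ * ‖w‖) := by
    rw [minkowski_squeeze_sub hB, abs_mul, show |ν ^ 2 - 1| = 1 - ν ^ 2 by
      rw [abs_sub_comm]; exact abs_of_nonneg (by nlinarith), abs_mul]
    exact mul_le_mul_of_nonneg_left (mul_le_mul (TameCensorship.Negative.abs_apply_le_norm v 3)
      (TameCensorship.Negative.abs_apply_le_norm w 3)
      (abs_nonneg _) (norm_nonneg _)) (by nlinarith)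
  have hBw : ‖B w‖ ≤ ‖w‖ := norm_squeeze_le hB (by nlinarith) w
  have hT2a : |kB (B v - v) (B w)| ≤ 16 * ((1 - ν) * ‖v‖) * ‖w‖ := by
    refine (Real.norm_eq_abs _ ▸ kB.le_opNorm₂ (B v - v) (B w)).trans ?_
    refine mul_le_mul (mul_le_mul hk ((norm_squeeze_sub_le hB v).trans_eq ?_) (norm_nonneg _) (by norm_num))
      hBw (norm_nonneg _) (by positivity)
    rw [abs_sub_comm, abs_of_nonneg (by linarith)]
  have hT2b : |kB v (B w - w)| ≤ 16 * ‖v‖ * ((1 - ν) * ‖w‖) := by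
    refine (Real.norm_eq_abs _ ▸ kB.le_opNorm₂ v (B w - w)).trans ?_
    refine mul_le_mul (mul_le_mul_of_nonneg_right hk (norm_nonneg _)) ((norm_squeeze_sub_le hB w).trans_eq ?_)
      (norm_nonneg _) (by positivity)
    rw [abs_sub_comm, abs_of_nonneg (by linarith)]
  have hT3' : |(kB - kq) v w| ≤ ‖kB - kq‖ * ‖v‖ * ‖w‖ := Real.norm_eq_abs _ ▸ (kB - kq).le_opNorm₂ v w
  have hvw : 0 ≤ ‖v‖ * ‖w‖ := by positivity
  have hmain : |(1 + ν ^ 2) / (2 * ν) * (kB (B v) (B w) - kq v w)| ≤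
      (5 / 4 * (32 * (1 - ν)) + (1 / 128 + 1 / 128)) * (‖v‖ * ‖w‖) := by
    rw [abs_mul, abs_of_nonneg hM₁0, e0]
    have h1 : |kB (B v - v) (B w) + kB v (B w - w) + (kB - kq) v w| ≤
        32 * (1 - ν) * (‖v‖ * ‖w‖) + ‖kB - kq‖ * (‖v‖ * ‖w‖) := by
      refine (abs_add_le _ _).trans (add_le_add ((abs_add_le _ _).trans ?_) (by linarith))
      linarith
    calc (1 + ν ^ 2) / (2 * ν) * |kB (B v - v) (B w) + kB v (B w - w) + (kB - kq) v w|
        ≤ (1 + ν ^ 2) / (2 * ν) * (32 * (1 - ν) * (‖v‖ * ‖w‖) + ‖kB - kq‖ * (‖v‖ * ‖w‖)) :=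
          mul_le_mul_of_nonneg_left h1 hM₁0
      _ = (1 + ν ^ 2) / (2 * ν) * (32 * (1 - ν)) * (‖v‖ * ‖w‖) +
            (1 + ν ^ 2) / (2 * ν) * ‖kB - kq‖ * (‖v‖ * ‖w‖) := by ring
      _ ≤ 5 / 4 * (32 * (1 - ν)) * (‖v‖ * ‖w‖) + (1 / 128 + 1 / 128) * (‖v‖ * ‖w‖) :=
          add_le_add (mul_le_mul_of_nonneg_right (mul_le_mul_of_nonneg_right hM₁ (by linarith)) hvw)
            (mul_le_mul_of_nonneg_right hT3 hvw)
      _ = _ := by ring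
  have htot : (1 - ν ^ 2) + (5 / 4 * (32 * (1 - ν)) + (1 / 128 + 1 / 128)) ≤ 1 / 32 := by
    have h2 : 1 - ν ^ 2 ≤ 2 * ε := by
      nlinarith [mul_le_mul_of_nonneg_right h1ν (by linarith : (0 : ℝ) ≤ 1 + ν)]
    linarith
  calc |Minkowski.bilin (B v) (B w) - Minkowski.bilin v w + (1 + ν ^ 2) / (2 * ν) * (kB (B v) (B w) - kq v w)|
      ≤ |Minkowski.bilin (B v) (B w) - Minkowski.bilin v w| +
          |(1 + ν ^ 2) / (2 * ν) * (kB (B v) (B w) - kq v w)| := abs_add_le _ _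
    _ ≤ (1 - ν ^ 2) * (‖v‖ * ‖w‖) + (5 / 4 * (32 * (1 - ν)) + (1 / 128 + 1 / 128)) * (‖v‖ * ‖w‖) :=
        add_le_add hT1 hmain
    _ = ((1 - ν ^ 2) + (5 / 4 * (32 * (1 - ν)) + (1 / 128 + 1 / 128))) * (‖v‖ * ‖w‖) := by ring
    _ ≤ 1 / 32 * (‖v‖ * ‖w‖) := mul_le_mul_of_nonneg_right htot hvw
    _ = 1 / 32 * ‖v‖ * ‖w‖ := by ring

end Anchor

/-- **Summary (registered sub-goal): the `C⁰` anchor of the masquerade** — for `ν` close enough to `1` the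
squeezed form is `1/32`-close to `g_{(1+ν²)/2, ν}` on `{r_ν > 1}` (hypothesis H4 of the no-hair stub). [folklore] -/
theorem innerHorizonMasquerade_anchor : ∃ ν₀ : ℝ, ν₀ < 1 ∧ ∀ ν : ℝ, ν₀ ≤ ν → ν < 1 → ∀ (B : E4 →L[ℝ] E4) (G : E4 → E4 →L[ℝ] E4 →L[ℝ] ℝ), (∀ w : E4, B w = w + ((ν - 1) * w 3) • E4.basisVector 3) → (∀ y v w : E4, G y v w = Kerr.bilin ((1 + ν ^ 2) / (2 * ν)) 1 (B y) (B v) (B w)) → ∀ x : E4, 1 < Kerr.radius ν x → ‖G x - Kerr.bilin ((1 + ν ^ 2) / 2) ν x‖ ≤ 1 / 32 := by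
  obtain ⟨C₁, hC0, hC₁⟩ := exists_bound_fderiv_ksPert_one_one
  have hpos : (0 : ℝ) < 1 / (8388608 * (C₁ + 1)) := by positivity
  exact ⟨1 - 1 / (8388608 * (C₁ + 1)), by linarith, fun ν hν hν1 B G hB hG x hx ↦
    squeezed_anchor hB hG hC0 hC₁ hν hν1 hx⟩

end Summit.FinalStateConjecture.FinalStateConjecture.Theorems.ClusterCompleteness

end
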